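import Literature.MathematicalPhysics.QuantumFieldTheory.Balaban1983to89.T3NestedUnitLaws
import Literature.MathematicalPhysics.QuantumFieldTheory.Balaban1983to89.T4FiniteEpsInhabited
import Literature.MathematicalPhysics.QuantumFieldTheory.Balaban1983to89.BlockAveragingEMLHaarAC

/-!
# `Balaban1983to89.T3UnitLawDensityEML` — at the PRINTED smearing `ℰ = expMeanLogSU` on `SU(2)` the renormalised densities
# `ρ_k` of [Balaban1985UV3] (1)–(2) of every d = 3 approximation are CONSTRUCTED (Radon–Nikodym transport over Bałaban's block
# averaging, whose push-forward of Haar measure is absolutely continuous in the tree), the unit law IS `ρ_K dV/Z`, and the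
# expectations step (E3) becomes ONE two-run sandwich of these densities, modulo constants, plus bad-set masses

Cell `ym3-torus` (HUMAN RULING D-0037, YM ladder rung R3), seat `ym3-torus-p2` gen 2 (E3-node holder).  WHAT THIS IS NOT: not d = 4,
not infinite volume, not a mass gap, not Clay, not (E3): the densities are constructed ABSTRACTLY (Radon–Nikodym derivatives), no
bound of [Balaban1985UV3] on them is asserted; the sandwich and the bad-set masses remain HYPOTHESES (they are the d = 3
expectations step); the positivity of the constructed densities is a hypothesis too (true for the fibre integrals of the
printed construction, not supplied by a Radon–Nikodym version).

THE CHAIN, BY NAME.  (i) `BlockAveragingEMLHaarAC.haarAC_avgFun_expMeanLogSU_of_le` (tree; every torus of `Setup.Params` in the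
standing range, d-generic): the push-forward of product Haar measure under the (0.4) averaging with the printed exp-mean-log
average on `SU(2)` is absolutely continuous; (ii) `T4FiniteEpsInhabited.rtOpIOfAC` (tree): hence a renormalization transformation
in the inhabited carrier `RTOpI` at every level `j` with `j + 1 ≤ m + K` — all the levels the `K`-th approximation uses; (iii)
§1 below: the densities `emlDensity F γ K k` = `T_{k−1}⋯T_0 e^{−β_K A}` ((1)–(2), `g₀² = γε_K`, `E = 0`), non-negative, measurable,
integrable, with the push-forward identity `∫ ρ_k f dV_k = ∫ e^{−β_K A} (f ∘ avg^k) dU` ((2)/(6) with a test function); (iv) §2: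
**`integral_unitLaw_eq_emlDensity`** — `∫ f d(unitLaw K) = (∫ ρ_K(V) f(unitShift V) dV_K)/Z` — and the density form
**`unitLaw_eq_withDensity_emlDensity`** (the unit law is `Z⁻¹ρ_K`, read on the unit labels, times product Haar on `T₁`), with NO
tower hypothesis left; (v) §3: **`continuumYM3Torus_printed_of_sandwich`** — `ContinuumYM3Torus F expMeanLogSU γ` (all four
conjuncts) from: positivity of the constructed `ρ_K`, measurable good sets `Gd_K` of unit fields, FREE constants `c_K > 0` and radii
`r_K` with `e^{−r_K}c_K ρ̂_K ≤ ρ̂_{K+1} ≤ e^{r_K}c_K ρ̂_K` on `Gd_K` (`ρ̂_K` = `ρ_K` of the `K`-th approximation read on the unit labels —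
UNNORMALISED: the partition functions go into `c_K`), bad-set masses `μ_K(Gd_Kᶜ) ≤ w_K ≤ 1/2`, `μ_{K+1}(Gd_Kᶜ) ≤ w'_K`, and
`Σ((e^{r_K})²/(1−w_K) − 1 + w'_K), Σ w_K, Σ w'_K < ∞` (`T3NestedUnitLaws.continuumYM3Torus_of_densitySandwichModConst`).
-/

noncomputable section

open MeasureTheory Filter Topology
open Literature.MathematicalPhysics.QuantumFieldTheory.Balaban1983to89.T3ContinuumYM3Torus
open Literature.MathematicalPhysics.QuantumFieldTheory.Balaban1983to89.T3LevelShift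
open Literature.MathematicalPhysics.QuantumFieldTheory.Balaban1983to89.T3ThresholdRemoval
open Literature.MathematicalPhysics.QuantumFieldTheory.Balaban1983to89.T3NestedUnitLaws
open Literature.MathematicalPhysics.QuantumFieldTheory.Balaban1983to89.Missing
open Literature.MathematicalPhysics.QuantumFieldTheory.Balaban1983to89.T4Continuum

namespace Literature.MathematicalPhysics.QuantumFieldTheory.Balaban1983to89.T3UnitLawDensityEML

/-- The printed small-loop average of [Balaban1987RG1] (0.4) on `SU(2)` (tree `ExpMeanLog.expMeanLogSU`). [cite: Balaban1987RG1, (0.4) p.253] -/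
abbrev ℰp : LoopAverage (Matrix.specialUnitaryGroup (Fin 2) ℂ) := ExpMeanLog.expMeanLogSU (n := Fin 2)

/-- `ℰp` is measurable in every arity (tree `ExpMeanLog.measurable_expMeanLogSU_E`). [cite: Balaban1987RG1, (0.4) p.253] -/
theorem measurableE_ℰp : (ℰp).MeasurableE := ExpMeanLog.measurable_expMeanLogSU_E

/-! ## §1 The renormalised densities of the `K`-th approximation, constructed -/

section Densities

variable (F : T3Family) (γ : ℝ) (K : ℕ)

/-- The (0.4) block averaging of the `K`-th approximation at level `j` is measurable. [cite: Balaban1987RG1, (0.4) p.253] -/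
theorem measurable_blockAvg (j : ℕ) :
    Measurable (BlockAveraging.blockAvg (P := F.P K) (j := j) ℰp).avg :=
  F.avgMeasurable_of_measurableE ℰp measurableE_ℰp K j

/-- **`HaarAC` for the scheme's averaging** in the standing range (tree `BlockAveragingEMLHaarAC.haarAC_avgFun_expMeanLogSU_of_le`,
d-generic). [cite: Balaban1987RG1, (0.4) p.253] -/
theorem haarAC_blockAvg {j : ℕ} (hj : j + 1 ≤ F.m + K) :
    T4FiniteEpsInhabited.HaarAC (BlockAveraging.blockAvg (P := F.P K) (j := j) ℰp).avg :=
  BlockAveragingEMLHaarAC.haarAC_avgFun_expMeanLogSU_of_le (P := F.P K) (j := j) hj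

/-- **THE RENORMALIZATION TRANSFORMATION at level `j`** of the `K`-th approximation (`j + 1 ≤ m + K`): the Radon–Nikodym transport
over the (0.4) averaging (tree `T4FiniteEpsInhabited.rtOpIOfAC`) — an inhabitant of `RTOpI`, i.e. an operator `T_j` with the
push-forward identity `∫ (T_jρ) f dV = ∫ ρ (f ∘ avg_j) dU` of [Balaban1985Averaging] (10) for integrable `ρ`. [cite: Balaban1985Averaging, (10) p.19] -/
def rt (j : ℕ) (hj : j + 1 ≤ F.m + K) :
    RTOpI (F.P K) j (Matrix.specialUnitaryGroup (Fin 2) ℂ) (BlockAveraging.blockAvg (P := F.P K) (j := j) ℰp) :=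
  T4FiniteEpsInhabited.rtOpIOfAC _ (measurable_blockAvg F K j) (haarAC_blockAvg F K hj)

/-- **THE RENORMALISED DENSITIES `ρ_k` OF THE `K`-TH APPROXIMATION, CONSTRUCTED**: `ρ₀ = e^{−β_K A}` ([Balaban1985UV3] (1) with
`g₀² = γε_K`, `E = 0`), `ρ_{k+1} = T_kρ_k` ((2)) for `k + 1 ≤ m + K` (all levels the approximation uses); `0` beyond the
standing range (never used). [cite: Balaban1985UV3, (1)–(2) p.256] -/
def emlDensity : (k : ℕ) → Density (F.P K) k (Matrix.specialUnitaryGroup (Fin 2) ℂ)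
  | 0 => boltzmann (F.P K) ((F.scheme ℰp γ).β K)
  | k + 1 => if h : k + 1 ≤ F.m + K then (rt F K k h).T (emlDensity k) else fun _ => 0

/-- `ρ₀ = e^{−β_K A}`. [cite: Balaban1985UV3, (1) p.256] -/
theorem emlDensity_zero : emlDensity F γ K 0 = boltzmann (F.P K) ((F.scheme ℰp γ).β K) := rfl

/-- `ρ_{k+1} = T_kρ_k` in the standing range. [cite: Balaban1985UV3, (2) p.256] -/
theorem emlDensity_succ {k : ℕ} (h : k + 1 ≤ F.m + K) :
    emlDensity F γ K (k + 1) = (rt F K k h).T (emlDensity F γ K k) := by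
  simp only [emlDensity, dif_pos h]

/-- `ρ_k ≥ 0` (`e^{−βA} > 0`, `RTOpI.pos`). [cite: Balaban1985UV3, (2) p.256] -/
theorem emlDensity_nonneg : ∀ (k : ℕ) (V : GaugeField (F.P K) k (Matrix.specialUnitaryGroup (Fin 2) ℂ)),
    0 ≤ emlDensity F γ K k V
  | 0, V => (boltzmann_pos _ _ V).le
  | k + 1, V => by
    by_cases h : k + 1 ≤ F.m + K
    · rw [emlDensity_succ F γ K h]
      exact (rt F K k h).pos _ (emlDensity_nonneg k) V
    · rw [emlDensity, dif_neg h]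

/-- `ρ_k` is measurable (Radon–Nikodym derivatives are). [cite: Balaban1985UV3, (2) p.256] -/
theorem measurable_emlDensity : ∀ k : ℕ, Measurable (emlDensity F γ K k)
  | 0 => measurable_boltzmann RegularGaugeGroup.measurable_reTr _ _
  | k + 1 => by
    by_cases h : k + 1 ≤ F.m + K
    · rw [emlDensity_succ F γ K h]
      show Measurable (AveragingRT.rnTransport (BlockAveraging.blockAvg (P := F.P K) (j := k) ℰp).avg (emlDensity F γ K k))
      have h0 := emlDensity_nonneg F γ K k
      have heq : AveragingRT.rnTransport (BlockAveraging.blockAvg (P := F.P K) (j := k) ℰp).avg (emlDensity F γ K k) =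
          AveragingRT.rnDensity (BlockAveraging.blockAvg (P := F.P K) (j := k) ℰp).avg (emlDensity F γ K k) := by
        funext V
        simp only [AveragingRT.rnTransport, if_pos h0]
      rw [heq]
      exact (Measure.measurable_rnDeriv _ _).ennreal_toReal
    · rw [emlDensity, dif_neg h]
      exact measurable_const

variable {γ}

/-- `ρ_k` is integrable in the standing range (`γ ≥ 0`; the transform of an integrable density is integrable,
`T4FiniteEpsInhabited.integrable_rnTransport_of_ac`). [cite: Balaban1985UV3, (6) p.257] -/
theorem integrable_emlDensity (hγ : 0 ≤ γ) : ∀ k : ℕ, k ≤ F.m + K →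
    Integrable (emlDensity F γ K k) (fieldMeasure (F.P K) k (Matrix.specialUnitaryGroup (Fin 2) ℂ))
  | 0, _ => integrable_boltzmann RegularGaugeGroup.measurable_reTr _ (F.scheme_β_nonneg ℰp hγ K)
  | k + 1, hk => by
    rw [emlDensity_succ F γ K hk]
    exact T4FiniteEpsInhabited.integrable_rnTransport_of_ac _ (measurable_blockAvg F K k) (haarAC_blockAvg F K hk) _
      (integrable_emlDensity hγ k (by omega))

/-- **(2)/(6) WITH A TEST FUNCTION, for the constructed densities**: `∫ ρ_k(V)·f(V) dV_k = ∫ e^{−β_K A(U)}·f(Ū^k) dU` for every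
bounded measurable `f`, `k ≤ m + K`. [cite: Balaban1985UV3, (2) p.256 + (6) p.257] -/
theorem integral_emlDensity_mul (hγ : 0 ≤ γ) : ∀ (k : ℕ), k ≤ F.m + K →
    ∀ (f : GaugeField (F.P K) k (Matrix.specialUnitaryGroup (Fin 2) ℂ) → ℝ), Measurable f → (∃ C : ℝ, ∀ V, |f V| ≤ C) →
      ∫ V, emlDensity F γ K k V * f V ∂fieldMeasure (F.P K) k (Matrix.specialUnitaryGroup (Fin 2) ℂ) =
        ∫ U, boltzmann (F.P K) ((F.scheme ℰp γ).β K) U *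
          f (Averaging.iter (fun j => BlockAveraging.blockAvg (P := F.P K) (j := j) ℰp) k U)
            ∂fieldMeasure (F.P K) 0 (Matrix.specialUnitaryGroup (Fin 2) ℂ)
  | 0, _, _, _, _ => rfl
  | k + 1, hk, f, hf, hC => by
    obtain ⟨C, hC⟩ := hC
    rw [emlDensity_succ F γ K hk]
    have step := (rt F K k hk).isRT _ (integrable_emlDensity F K hγ k (by omega)) f hf ⟨C, hC⟩
    rw [step]
    exact integral_emlDensity_mul hγ k (by omega) (fun U => f ((BlockAveraging.blockAvg (P := F.P K) (j := k) ℰp).avg U))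
      (hf.comp (measurable_blockAvg F K k)) ⟨C, fun U => hC _⟩

end Densities

/-! ## §2 The unit law at the printed smearing IS `ρ_K dV / Z`, no hypothesis left -/

section UnitLaw

variable (F : T3Family) {γ : ℝ} (K : ℕ)

/-- **THE UNIT LAW IS THE CONSTRUCTED RENORMALISED DENSITY, NORMALISED** (`SU(2)`, `ℰ = expMeanLogSU`, `γ ≥ 0`): for every bounded
measurable `f` on the unit-field space, `∫ f d(unitLaw K) = (∫ ρ_K(V)·f(unitShift V) dV_K)/Z`. [cite: Balaban1985UV3, (2) p.256 + (6) p.257] -/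
theorem integral_unitLaw_eq_emlDensity (hγ : 0 ≤ γ)
    (f : GaugeField (F.P 0) 0 (Matrix.specialUnitaryGroup (Fin 2) ℂ) → ℝ) (hf : Measurable f) (hC : ∃ C : ℝ, ∀ u, |f u| ≤ C) :
    ∫ u, f u ∂F.unitLaw ℰp measurableE_ℰp γ K =
      (∫ V, emlDensity F γ K K V * f (unitShift F K V) ∂fieldMeasure (F.P K) K (Matrix.specialUnitaryGroup (Fin 2) ℂ)) /
        partitionFn (G := Matrix.specialUnitaryGroup (Fin 2) ℂ) (F.P K) ((F.scheme ℰp γ).β K) := by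
  obtain ⟨C, hC⟩ := hC
  rw [integral_unitLaw measurableE_ℰp K hf, T4GenFunBounds.integral_gibbsMeasure _ (F.scheme_β_nonneg ℰp hγ K),
    integral_emlDensity_mul F K hγ K (Nat.le_add_left K F.m) (fun V => f (unitShift F K V))
      (hf.comp (measurable_unitShift F K)) ⟨C, fun V => hC _⟩]
  congr 1
  refine integral_congr_ae (Eventually.of_forall fun U => ?_)
  exact mul_comm _ _

/-- **THE RENORMALISED DENSITY READ ON THE UNIT LABELS**: `ρ̂_K(u) := ρ_K(unitShift⁻¹ u)` (unnormalised). [cite: Balaban1985UV3, (2) p.256] -/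
def unitDensity (γ : ℝ) (K : ℕ) (u : GaugeField (F.P 0) 0 (Matrix.specialUnitaryGroup (Fin 2) ℂ)) : ℝ :=
  emlDensity F γ K K (fieldShift (F.sitesPerDir_unit K).symm u)

/-- `ρ̂_K(unitShift V) = ρ_K(V)`. [cite: Balaban1985UV3, (2) p.256] -/
theorem unitDensity_unitShift (γ : ℝ) (V : GaugeField (F.P K) K (Matrix.specialUnitaryGroup (Fin 2) ℂ)) :
    unitDensity F γ K (unitShift F K V) = emlDensity F γ K K V := by
  unfold unitDensity
  rw [unitShift_eq, fieldShift_fieldShift_symm]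

/-- `ρ̂_K` is measurable, non-negative and integrable for product Haar on `T₁` (`γ ≥ 0`). [cite: Balaban1985UV3, (6) p.257] -/
theorem unitDensity_props (hγ : 0 ≤ γ) :
    Measurable (unitDensity F γ K) ∧ (∀ u, 0 ≤ unitDensity F γ K u) ∧
      Integrable (unitDensity F γ K) (fieldMeasure (F.P 0) 0 (Matrix.specialUnitaryGroup (Fin 2) ℂ)) :=
  ⟨(measurable_emlDensity F γ K K).comp (measurable_fieldShift _), fun _ => emlDensity_nonneg F γ K K _,
    (measurePreserving_fieldShift (F.sitesPerDir_unit K).symm).integrable_comp_of_integrable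
      (integrable_emlDensity F K hγ K (Nat.le_add_left K F.m))⟩

/-- Two finite measures with equal integrals of all measurable `f`, `|f| ≤ 1`, are equal (local helper). [folklore] -/
private theorem ext_of_forall_integral_eq {X : Type*} [MeasurableSpace X] {μ ν : Measure X} [IsFiniteMeasure μ]
    [IsFiniteMeasure ν] (h : ∀ f : X → ℝ, Measurable f → (∀ x, |f x| ≤ 1) → ∫ x, f x ∂μ = ∫ x, f x ∂ν) : μ = ν := by
  refine Measure.ext fun s hs => ?_
  have hb : ∀ y, |s.indicator (1 : X → ℝ) y| ≤ 1 := fun y => by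
    by_cases hy : y ∈ s
    · simp [hy]
    · simp [hy]
  have h1 := h _ (measurable_one.indicator hs) hb
  rw [integral_indicator_one hs, integral_indicator_one hs] at h1
  exact (ENNReal.toReal_eq_toReal_iff' (measure_ne_top _ _) (measure_ne_top _ _)).mp h1

/-- **THE UNIT LAW AT THE PRINTED SMEARING HAS THE DENSITY `Z⁻¹ρ̂_K` WITH RESPECT TO PRODUCT HAAR ON `T₁`** — hypothesis-free:
`unitLaw K = dV_{T₁}.withDensity (Z⁻¹ρ̂_K)` (`SU(2)`, `γ ≥ 0`).  In particular the `hlaw` hypothesis of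
`T3NestedUnitLaws.continuumYM3Torus_of_densitySandwich[ModConst]` holds for the constructed densities. [cite: Balaban1985UV3, (2) p.256 + (6) p.257] -/
theorem unitLaw_eq_withDensity_emlDensity (hγ : 0 ≤ γ) :
    F.unitLaw ℰp measurableE_ℰp γ K =
      (fieldMeasure (F.P 0) 0 (Matrix.specialUnitaryGroup (Fin 2) ℂ)).withDensity (fun u => ENNReal.ofReal
        ((partitionFn (G := Matrix.specialUnitaryGroup (Fin 2) ℂ) (F.P K) ((F.scheme ℰp γ).β K))⁻¹ * unitDensity F γ K u)) := by
  obtain ⟨hdm, hd0, hdi⟩ := unitDensity_props F K hγ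
  have hZ : 0 < partitionFn (G := Matrix.specialUnitaryGroup (Fin 2) ℂ) (F.P K) ((F.scheme ℰp γ).β K) :=
    partitionFn_pos' _ (F.scheme_β_nonneg ℰp hγ K)
  set Z := partitionFn (G := Matrix.specialUnitaryGroup (Fin 2) ℂ) (F.P K) ((F.scheme ℰp γ).β K) with hZdef
  have hm : Measurable fun u => Z⁻¹ * unitDensity F γ K u := hdm.const_mul _
  have h0 : ∀ u, 0 ≤ Z⁻¹ * unitDensity F γ K u := fun u => mul_nonneg (inv_nonneg.mpr hZ.le) (hd0 u)
  haveI := isProbabilityMeasure_unitLaw (F := F) (ℰ := ℰp) measurableE_ℰp hγ K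
  haveI : IsFiniteMeasure ((fieldMeasure (F.P 0) 0 (Matrix.specialUnitaryGroup (Fin 2) ℂ)).withDensity
      fun u => ENNReal.ofReal (Z⁻¹ * unitDensity F γ K u)) :=
    isFiniteMeasure_withDensity_ofReal (hdi.const_mul _).2
  refine ext_of_forall_integral_eq fun f hf hb => ?_
  rw [integral_unitLaw_eq_emlDensity F K hγ f hf ⟨1, hb⟩, T4VarianceMatching.integral_withDensity_ofReal_mul hm h0 f]
  have hcv : ∫ u, Z⁻¹ * unitDensity F γ K u * f u ∂fieldMeasure (F.P 0) 0 (Matrix.specialUnitaryGroup (Fin 2) ℂ) =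
      ∫ V, Z⁻¹ * unitDensity F γ K (unitShift F K V) * f (unitShift F K V)
        ∂fieldMeasure (F.P K) K (Matrix.specialUnitaryGroup (Fin 2) ℂ) :=
    (integral_comp_fieldShift (F.sitesPerDir_unit K) (fun u => Z⁻¹ * unitDensity F γ K u * f u)).symm
  rw [hcv]
  simp_rw [unitDensity_unitShift]
  rw [← integral_div]
  refine integral_congr_ae (Eventually.of_forall fun V => ?_)
  ring

end UnitLaw

/-! ## §3 The expectations step at the printed smearing as ONE sandwich of the constructed densities, modulo constants -/

section Sandwich

variable (F : T3Family) {γ : ℝ} (hγ : 0 ≤ γ)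

include hγ

/-- **R3 ON ONE THREE-TORUS AT THE PRINTED SMEARING ⇐ THE TWO-RUN SANDWICH OF THE CONSTRUCTED DENSITIES, MODULO CONSTANTS,
⊕ BAD-SET MASSES** (`SU(2)`, `ℰ = expMeanLogSU`, `γ ≥ 0`).  Hypotheses: the constructed renormalised densities are positive;
measurable good sets `Gd_K` of unit fields; FREE constants `c_K > 0`; radii `r_K ≥ 0` with
`e^{−r_K} c_K ρ̂_K ≤ ρ̂_{K+1} ≤ e^{r_K} c_K ρ̂_K` on `Gd_K` (UNNORMALISED densities of the two consecutive approximations read on the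
unit labels: partition functions and vacuum energies are absorbed in `c_K`); masses `μ_K(Gd_Kᶜ) ≤ w_K ≤ 1/2`, `μ_{K+1}(Gd_Kᶜ) ≤ w'_K`;
summability of `(e^{r_K})²/(1−w_K) − 1 + w'_K`, `w_K`, `w'_K`.  Conclusion: `ContinuumYM3Torus F expMeanLogSU γ` — existence and
uniqueness of the continuum limit of all joint expectations of unit-scale averaged loop variables, OS positivity, torus covariance.
[cite: Balaban1985UV3, (41) p.266 / (47) p.267] -/
theorem continuumYM3Torus_printed_of_sandwich
    (hpos : ∀ K u, 0 < unitDensity F γ K u)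
    (Gd : ℕ → Set (GaugeField (F.P 0) 0 (Matrix.specialUnitaryGroup (Fin 2) ℂ))) (hGd : ∀ K, MeasurableSet (Gd K))
    {r w w' : ℕ → ℝ} (c : ℕ → ℝ) (hr : ∀ K, 0 ≤ r K) (hc : ∀ K, 0 < c K) (hw1 : ∀ K, w K ≤ 1 / 2)
    (hsand : ∀ K, ∀ u ∈ Gd K, Real.exp (-r K) * c K * unitDensity F γ K u ≤ unitDensity F γ (K + 1) u ∧
      unitDensity F γ (K + 1) u ≤ Real.exp (r K) * c K * unitDensity F γ K u)
    (hw : ∀ K, (F.unitLaw ℰp measurableE_ℰp γ K).real (Gd K)ᶜ ≤ w K)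
    (hw' : ∀ K, (F.unitLaw ℰp measurableE_ℰp γ (K + 1)).real (Gd K)ᶜ ≤ w' K)
    (hs : Summable fun K => Real.exp (r K) ^ 2 / (1 - w K) - 1 + w' K) (hws : Summable w) (hws' : Summable w') :
    ContinuumYM3Torus F ℰp γ := by
  -- the normalised densities and the constants carrying the partition functions
  let Z : ℕ → ℝ := fun K => partitionFn (G := Matrix.specialUnitaryGroup (Fin 2) ℂ) (F.P K) ((F.scheme ℰp γ).β K)
  have hZ : ∀ K, 0 < Z K := fun K => partitionFn_pos' _ (F.scheme_β_nonneg ℰp hγ K)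
  let ρ : ℕ → GaugeField (F.P 0) 0 (Matrix.specialUnitaryGroup (Fin 2) ℂ) → ℝ := fun K u => (Z K)⁻¹ * unitDensity F γ K u
  refine continuumYM3Torus_of_densitySandwichModConst F ℰp measurableE_ℰp hγ
    (fieldMeasure (F.P 0) 0 (Matrix.specialUnitaryGroup (Fin 2) ℂ)) ρ
    (fun K => (unitDensity_props F K hγ).1.const_mul _)
    (fun K u => mul_pos (inv_pos.mpr (hZ K)) (hpos K u))
    (fun K => unitLaw_eq_withDensity_emlDensity F K hγ) Gd hGd (fun K => c K * Z K / Z (K + 1)) hr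
    (fun K => div_pos (mul_pos (hc K) (hZ K)) (hZ (K + 1))) hw1 (fun K u hu => ?_) hw hw' hs hws hws'
  -- the sandwich for the normalised densities
  obtain ⟨h1, h2⟩ := hsand K u hu
  have hZK : Z K ≠ 0 := (hZ K).ne'
  have hZK1 := hZ (K + 1)
  have hZK1' : Z (K + 1) ≠ 0 := hZK1.ne'
  constructor
  · show Real.exp (-r K) * (c K * Z K / Z (K + 1)) * ((Z K)⁻¹ * unitDensity F γ K u) ≤
      (Z (K + 1))⁻¹ * unitDensity F γ (K + 1) u
    have e : Real.exp (-r K) * (c K * Z K / Z (K + 1)) * ((Z K)⁻¹ * unitDensity F γ K u) =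
        (Z (K + 1))⁻¹ * (Real.exp (-r K) * c K * unitDensity F γ K u) := by
      field_simp
    rw [e]
    exact mul_le_mul_of_nonneg_left h1 (inv_nonneg.mpr hZK1.le)
  · show (Z (K + 1))⁻¹ * unitDensity F γ (K + 1) u ≤
      Real.exp (r K) * (c K * Z K / Z (K + 1)) * ((Z K)⁻¹ * unitDensity F γ K u)
    have e : Real.exp (r K) * (c K * Z K / Z (K + 1)) * ((Z K)⁻¹ * unitDensity F γ K u) =
        (Z (K + 1))⁻¹ * (Real.exp (r K) * c K * unitDensity F γ K u) := by
      field_simp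
    rw [e]
    exact mul_le_mul_of_nonneg_left h2 (inv_nonneg.mpr hZK1.le)

end Sandwich

end Literature.MathematicalPhysics.QuantumFieldTheory.Balaban1983to89.T3UnitLawDensityEML

end
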